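import Summits.RiemannHypothesis.RiemannHypothesis.Theses.WeilComb
import Literature.NumberTheory.LFunctions.UniformWeilPositivityRH

/-!
# RiemannHypothesis / WeilComb — the assembly `Assembly` (uniform Weil positivity ⇒ RH)

Settles item stmt-RiemannHypothesis-0099 (`Assembly`, rank 1), shared verbatim by the routes
`WeilComb`, `WeilPos` and `WeilAdversary`:

  `(∀ a : ℝ, 0 < a → Literature.NumberTheory.LFunctions.WeilPositivityOn a) → Summit.RiemannHypothesis`,

the hard direction of Weil's criterion in Yoshida's fixed-support form: if Weil's quadratic
functional `Re W(g ⋆ g̃)` is non-negative on every truncated cone of tests supported in `[-a, a]`,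
`a > 0`, then every non-trivial zero of `ζ` lies on the critical line.

Nothing here is new mathematics. The criterion is an unconditional theorem of the tree,
`Literature.NumberTheory.LFunctions.riemannHypothesis_iff_forall_weilPositivityOn :
RiemannHypothesis ↔ ∀ a > 0, WeilPositivityOn a` (`Literature/NumberTheory/LFunctions/UniformWeilPositivityRH.lean`),
obtained from the discharged named fact `weil_criterion_holds : RiemannHypothesis ↔ WeilPositivity`
(`WeilCriterionProofs.lean`: the Guinand–Weil explicit formula `explicit_formula_holds` plus both
halves of Bombieri 2000 Thm. 1, the "if" half being `WeilConverse.riemannHypothesis_of_zeroSide_nonneg`)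
composed with `uniformWeilPositivity_iff_weilPositivity` (`WeilCriterion.lean`). The assembly is the
`mpr` direction of that equivalence, transported along the unfolding lemma
`Summit.RiemannHypothesis_iff : Summit.RiemannHypothesis ↔ _root_.RiemannHypothesis`.

This file gives the term with the `WeilComb` route decl as its literal type (the item is the same
ledger item for all three routes, whose `Assembly` decls are syntactically identical; no auxiliary
declaration is introduced: a lemma concluding `Summit.RiemannHypothesis` under a hypothesis would
read as a conditional proof of the summit).

References: A. Weil, *Sur les "formules explicites" de la théorie des nombres premiers*, Comm. Sém.
Math. Univ. Lund (1952) 252–265; E. Bombieri, *Remarks on Weil's quadratic functional in the theory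
of prime numbers I*, Rend. Mat. Acc. Lincei (9) 11 (2000) 183–233, Thms. 1–2; H. Yoshida, *On
Hermitian forms attached to zeta functions*, Adv. Stud. Pure Math. 21 (1992) 281–325.
-/

namespace Summit.RiemannHypothesis.RiemannHypothesis.Theorems

open Summit.RiemannHypothesis.RiemannHypothesis.Theses

/-- **Assembly of route WeilComb** (item stmt-RiemannHypothesis-0099):
`(∀ a > 0, WeilPositivityOn a) → Summit.RiemannHypothesis`, Weil's criterion in the direction
positivity ⇒ RH: the `mpr` direction of Yoshida's criterion
`Literature.NumberTheory.LFunctions.riemannHypothesis_iff_forall_weilPositivityOn` (unconditional in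
the tree via `weil_criterion_holds`), read through `Summit.RiemannHypothesis_iff`. [cite: Bombieri2000Weil, Thm. 2] -/
theorem weilCombAssembly_proof : WeilComb.Assembly := by
  unfold WeilComb.Assembly
  exact fun h =>
    Summit.RiemannHypothesis_iff.mpr
      (Literature.NumberTheory.LFunctions.riemannHypothesis_iff_forall_weilPositivityOn.mpr h)

end Summit.RiemannHypothesis.RiemannHypothesis.Theorems
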